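import Mathlib
import HarnessLib
import Summits.HubbardSuperconductivity.HubbardSuperconductivity.Theorems.KLProgrammeC4aAntidiagonalFlatnessL1

/-!
# Route `KLProgramme` — crux C4a, S3 brick (B4) «(B4)-UMK1», «(M1)-TRUE-KERNEL» adaptation (Ω): the anti-diagonal flatness number at NONZERO TRANSFER FREQUENCY —
# kernel `N(e,u)·κ(e/(e+u))/(e+u − iΩ)` (complex numerator): the Ω = 0 identity times `D/(D − iΩ)` plus ONE extra term `−(iΩ/(D(D−iΩ)²))·∫ N·κ`

Cell `gate-hubbard-kl`, seat hubbard-kl-k3c3-p1 (g15; row «δμ-flow with klAngularMean constant piece»).  Companion of `…C4aAntidiagonalFlatnessL1` (p674073) for the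
(U1) chain of hubbard-kl-k3c3-p3 / the (C) closer (stub (C) of stmt-HubbardSuperconductivity-20437; note `M1-TRUE-KERNEL.md` §5 residual «Ω = κ + p₀ ≠ 0»).  By
`…C4aPPKernelRatioForm` the pair kernel at transfer frequency `Ω` is `N_Ω(e,u)/(e+u−iΩ)`; along the anti-diagonal `e + u = D` the denominator is the CONSTANT `D − iΩ`
but its `u`-derivative is `−(D−iΩ)⁻²`, so the degree-(−1) homogeneity used at `Ω = 0` is broken by exactly one term:
* §1 **`intervalIntegral_antidiagonal_eq_cutoff_pieces_complex`** — the Ω = 0 IBP identity for a COMPLEX numerator (`n, n₁, n₂ : ℝ → ℂ`, real split `κ`);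
  **`norm_integral_antidiagonal_flatness_le_of_L1_complex`** (`‖∫ Ku₀‖ ≤ (M₁+M₂)/D²`);
* §2 `transferKernel_integrand_eq` — with `c = (D − iΩ)⁻¹`: `∂ᵤ[Nκ c] ≡ KuΩ = c·D·Ku₀ − (iΩc²/D)·(n·κ)` pointwise on the line; `hasDerivAt_transferKernel_u` (it IS the
  `u`-derivative); `norm_transfer_inv_le` (`‖c‖ ≤ 1/D`, `‖c‖² ≤ 1/(D²+Ω²)`);
* §3 **`norm_integral_antidiagonal_flatness_transfer_le`** — `‖∫_0^D KuΩ‖ ≤ (M₁+M₂)/D² + |Ω|/(D(D²+Ω²))·∫_0^D ‖n·κ(e/D)‖`: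
  the Ω = 0 flatness number plus an extra term of size `|Ω|·N_line/D³` — `lo/D²`-class with `lo = |Ω|` when `∫‖nκ‖ ≲ D` (true kernel: `|N| ≤ 1`), and `≤ S·κ₀/2`-bounded on
  short lines where `|N| ≤ S·D` (`|Ω|D²/(D(D²+Ω²)) ≤ 1/2`); since `|Ω| = |κ + p₀| ≲ Λₙ` for the kept frequencies, the transfer frequency never leaves the `A₁/A₃` slots.
Pure real/complex analysis; nothing asserts (C), K3 or superconductivity.
References: FST II CPAM 51 (1998) §3 [cite: FeldmanSalmhoferTrubowitz1998]; BGM 2006 §2.1 (2.3) [cite: BenfattoGiulianiMastropietro2006].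
-/

noncomputable section

namespace Summit.HubbardSuperconductivity.HubbardSuperconductivity.Theorems.C4a

set_option linter.dupNamespace false -- summit = problem name (single-conjunct summit), D-0017

open Real Set MeasureTheory intervalIntegral Complex
open scoped Interval

/-! ## §1 The Ω = 0 identity with a complex numerator -/

/-- **THE ANTI-DIAGONAL IBP IDENTITY, COMPLEX NUMERATOR.**  `0 < D`; `n, n₁, n₂ : ℝ → ℂ` with `n′ = n₁ − n₂` on `[0,D]` (continuous densities), real `κ ∈ C¹`,
boundary `n(D)·κ(1) = 0`, `Ku(e) = n₂κ(e/D)/D − n(κ′(e/D)(e/D) + κ(e/D))/D²`.  THEN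
`∫_0^D Ku = (1/D)(∫_0^D n₁·((e/D)κ(e/D)) + ∫_0^D n₂·(((D−e)/D)κ(e/D)))`. [cite: FeldmanSalmhoferTrubowitz1998, §3] -/
theorem intervalIntegral_antidiagonal_eq_cutoff_pieces_complex {n n₁ n₂ Ku : ℝ → ℂ} {κ κ' : ℝ → ℝ} {D : ℝ} (hD : 0 < D)
    (hn : ∀ e ∈ Icc 0 D, HasDerivAt n (n₁ e - n₂ e) e) (hn₁c : Continuous n₁) (hn₂c : Continuous n₂)
    (hκ : ∀ t, HasDerivAt κ (κ' t) t) (hκ'c : Continuous κ')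
    (hbd : n D * (κ 1 : ℂ) = 0)
    (hKu : ∀ e ∈ Icc 0 D, Ku e = n₂ e * (κ (e / D) : ℂ) / D - n e * ((κ' (e / D) * (e / D) + κ (e / D) : ℝ) : ℂ) / (D : ℂ) ^ 2) :
    ∫ e in (0 : ℝ)..D, Ku e =
      (1 / (D : ℂ)) * ((∫ e in (0 : ℝ)..D, n₁ e * ((e / D * κ (e / D) : ℝ) : ℂ)) + ∫ e in (0 : ℝ)..D, n₂ e * (((D - e) / D * κ (e / D) : ℝ) : ℂ)) := by
  have hκc : Continuous κ := continuous_iff_continuousAt.2 fun t => (hκ t).continuousAt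
  have hD0 : D ≠ 0 := hD.ne'
  have hDc : (D : ℂ) ≠ 0 := Complex.ofReal_ne_zero.2 hD0
  -- the bulk primitive `m(e) = (e/D)·κ(e/D)` (real) and its derivative, then coerced
  set m : ℝ → ℝ := fun e => e / D * κ (e / D) with hm
  set m' : ℝ → ℝ := fun e => (κ' (e / D) * (e / D) + κ (e / D)) / D with hm'
  have hmd : ∀ e, HasDerivAt m (m' e) e := fun e => by
    have h1 : HasDerivAt (fun e : ℝ => e / D) (1 / D) e := by simpa using (hasDerivAt_id e).div_const D
    have h2 : HasDerivAt (fun e : ℝ => κ (e / D)) (κ' (e / D) * (1 / D)) e := (hκ (e / D)).comp e h1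
    refine (h1.mul h2).congr_deriv ?_
    simp only [hm']; field_simp; ring
  have hm'c : Continuous m' := by
    simp only [hm']
    exact (((hκ'c.comp (continuous_id.div_const D)).mul (continuous_id.div_const D)).add (hκc.comp (continuous_id.div_const D))).div_const D
  have hmc : Continuous m := (continuous_id.div_const D).mul (hκc.comp (continuous_id.div_const D))
  have hmdC : ∀ e, HasDerivAt (fun x => (m x : ℂ)) ((m' e : ℂ)) e := fun e => (hmd e).ofReal_comp
  have hnc : ContinuousOn n (Icc 0 D) := fun e he => (hn e he).continuousAt.continuousWithinAt
  have hmD : (m D : ℂ) = κ 1 := by simp only [hm]; rw [div_self hD0, one_mul]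
  have hm0 : (m 0 : ℂ) = 0 := by simp only [hm]; rw [zero_div, zero_mul]; simp
  -- integration by parts in `ℂ`
  have hIBP : ∫ e in (0 : ℝ)..D, n e * (m' e : ℂ) = -∫ e in (0 : ℝ)..D, (n₁ e - n₂ e) * (m e : ℂ) := by
    have h := intervalIntegral.integral_mul_deriv_eq_deriv_mul (a := (0 : ℝ)) (b := D) (u := n) (v := fun x => (m x : ℂ))
      (u' := fun e => n₁ e - n₂ e) (v' := fun e => (m' e : ℂ)) (fun e he => hn e (by rwa [uIcc_of_le hD.le] at he)) (fun e _ => hmdC e)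
      ((hn₁c.sub hn₂c).intervalIntegrable _ _) ((continuous_ofReal.comp hm'c).intervalIntegrable _ _)
    rw [h, hmD, hm0, hbd, mul_zero, sub_zero, zero_sub]
  -- rewrite the integrand
  have hKu' : ∀ e ∈ uIcc (0 : ℝ) D, Ku e = (1 / (D : ℂ)) * (n₂ e * (κ (e / D) : ℂ)) - (1 / (D : ℂ)) * (n e * (m' e : ℂ)) := fun e he => by
    rw [uIcc_of_le hD.le] at he
    rw [hKu e he]
    simp only [hm']
    push_cast
    field_simp
  have hi₂ : IntervalIntegrable (fun e => n₂ e * (κ (e / D) : ℂ)) volume 0 D :=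
    (hn₂c.mul (continuous_ofReal.comp (hκc.comp (continuous_id.div_const D)))).intervalIntegrable _ _
  have hi₃ : IntervalIntegrable (fun e => n e * (m' e : ℂ)) volume 0 D :=
    (hnc.mul (continuous_ofReal.comp hm'c).continuousOn).intervalIntegrable_of_Icc hD.le
  rw [intervalIntegral.integral_congr hKu', intervalIntegral.integral_sub (hi₂.const_mul _) (hi₃.const_mul _),
    intervalIntegral.integral_const_mul, intervalIntegral.integral_const_mul, hIBP]
  have hi₄ : IntervalIntegrable (fun e => n₁ e * (m e : ℂ)) volume 0 D := (hn₁c.mul (continuous_ofReal.comp hmc)).intervalIntegrable _ _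
  have hi₅ : IntervalIntegrable (fun e => n₂ e * (((D - e) / D * κ (e / D) : ℝ) : ℂ)) volume 0 D :=
    (hn₂c.mul (continuous_ofReal.comp (((continuous_const.sub continuous_id).div_const D).mul (hκc.comp (continuous_id.div_const D))))).intervalIntegrable _ _
  have hsplit : (∫ e in (0 : ℝ)..D, n₂ e * (κ (e / D) : ℂ)) + ∫ e in (0 : ℝ)..D, (n₁ e - n₂ e) * (m e : ℂ) =
      (∫ e in (0 : ℝ)..D, n₁ e * (m e : ℂ)) + ∫ e in (0 : ℝ)..D, n₂ e * (((D - e) / D * κ (e / D) : ℝ) : ℂ) := by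
    have hi₆ : IntervalIntegrable (fun e => (n₁ e - n₂ e) * (m e : ℂ)) volume 0 D :=
      ((hn₁c.sub hn₂c).mul (continuous_ofReal.comp hmc)).intervalIntegrable _ _
    rw [← intervalIntegral.integral_add hi₂ hi₆, ← intervalIntegral.integral_add hi₄ hi₅]
    refine intervalIntegral.integral_congr fun e _ => ?_
    simp only [hm]
    push_cast
    field_simp
    ring
  rw [← hsplit]
  simp only [hm]
  ring

/-- **`‖∫_0^D Ku₀‖ ≤ (M₁ + M₂)/D²`** for a complex numerator, from `∫_0^D ‖n₁ e‖·|κ(e/D)|·e ≤ M₁`, `∫_0^D ‖n₂ e‖·|κ(e/D)|·(D−e) ≤ M₂`. [cite: FeldmanSalmhoferTrubowitz1998, §3] -/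
theorem norm_integral_antidiagonal_flatness_le_of_L1_complex {n n₁ n₂ Ku : ℝ → ℂ} {κ κ' : ℝ → ℝ} {D M₁ M₂ : ℝ} (hD : 0 < D)
    (hn : ∀ e ∈ Icc 0 D, HasDerivAt n (n₁ e - n₂ e) e) (hn₁c : Continuous n₁) (hn₂c : Continuous n₂)
    (hκ : ∀ t, HasDerivAt κ (κ' t) t) (hκ'c : Continuous κ')
    (hbd : n D * (κ 1 : ℂ) = 0)
    (hKu : ∀ e ∈ Icc 0 D, Ku e = n₂ e * (κ (e / D) : ℂ) / D - n e * ((κ' (e / D) * (e / D) + κ (e / D) : ℝ) : ℂ) / (D : ℂ) ^ 2)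
    (hM₁ : ∫ e in (0 : ℝ)..D, ‖n₁ e‖ * |κ (e / D)| * e ≤ M₁) (hM₂ : ∫ e in (0 : ℝ)..D, ‖n₂ e‖ * |κ (e / D)| * (D - e) ≤ M₂) :
    ‖∫ e in (0 : ℝ)..D, Ku e‖ ≤ (M₁ + M₂) / D ^ 2 := by
  have hκc : Continuous κ := continuous_iff_continuousAt.2 fun t => (hκ t).continuousAt
  have hκDc : Continuous fun e : ℝ => |κ (e / D)| := (hκc.comp (continuous_id.div_const D)).abs
  rw [intervalIntegral_antidiagonal_eq_cutoff_pieces_complex hD hn hn₁c hn₂c hκ hκ'c hbd hKu, norm_mul]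
  have hnD : ‖(1 / (D : ℂ))‖ = 1 / D := by rw [norm_div, norm_one, Complex.norm_of_nonneg hD.le]
  rw [hnD]
  have hp1 : ‖∫ e in (0 : ℝ)..D, n₁ e * ((e / D * κ (e / D) : ℝ) : ℂ)‖ ≤ M₁ / D := by
    have h := intervalIntegral.norm_integral_le_of_norm_le (μ := volume) hD.le
      (f := fun e => n₁ e * ((e / D * κ (e / D) : ℝ) : ℂ)) (g := fun e => (1 / D) * (‖n₁ e‖ * |κ (e / D)| * e))
      (Filter.Eventually.of_forall fun e he => by
        rw [norm_mul, Complex.norm_real, Real.norm_eq_abs, abs_mul, abs_of_nonneg (div_nonneg he.1.le hD.le)]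
        exact le_of_eq (by field_simp))
      ((continuous_const.mul ((hn₁c.norm.mul hκDc).mul continuous_id)).intervalIntegrable _ _)
    rw [intervalIntegral.integral_const_mul] at h
    calc ‖∫ e in (0 : ℝ)..D, n₁ e * ((e / D * κ (e / D) : ℝ) : ℂ)‖ ≤ 1 / D * ∫ e in (0 : ℝ)..D, ‖n₁ e‖ * |κ (e / D)| * e := h
      _ ≤ 1 / D * M₁ := mul_le_mul_of_nonneg_left hM₁ (by positivity)
      _ = M₁ / D := by field_simp
  have hp2 : ‖∫ e in (0 : ℝ)..D, n₂ e * (((D - e) / D * κ (e / D) : ℝ) : ℂ)‖ ≤ M₂ / D := by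
    have h := intervalIntegral.norm_integral_le_of_norm_le (μ := volume) hD.le
      (f := fun e => n₂ e * (((D - e) / D * κ (e / D) : ℝ) : ℂ)) (g := fun e => (1 / D) * (‖n₂ e‖ * |κ (e / D)| * (D - e)))
      (Filter.Eventually.of_forall fun e he => by
        rw [norm_mul, Complex.norm_real, Real.norm_eq_abs, abs_mul, abs_of_nonneg (div_nonneg (by linarith [he.2]) hD.le)]
        exact le_of_eq (by field_simp))
      ((continuous_const.mul ((hn₂c.norm.mul hκDc).mul (continuous_const.sub continuous_id))).intervalIntegrable _ _)
    rw [intervalIntegral.integral_const_mul] at h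
    calc ‖∫ e in (0 : ℝ)..D, n₂ e * (((D - e) / D * κ (e / D) : ℝ) : ℂ)‖ ≤ 1 / D * ∫ e in (0 : ℝ)..D, ‖n₂ e‖ * |κ (e / D)| * (D - e) := h
      _ ≤ 1 / D * M₂ := mul_le_mul_of_nonneg_left hM₂ (by positivity)
      _ = M₂ / D := by field_simp
  calc 1 / D * ‖(∫ e in (0 : ℝ)..D, n₁ e * ((e / D * κ (e / D) : ℝ) : ℂ)) + ∫ e in (0 : ℝ)..D, n₂ e * (((D - e) / D * κ (e / D) : ℝ) : ℂ)‖
      ≤ 1 / D * (M₁ / D + M₂ / D) := mul_le_mul_of_nonneg_left ((norm_add_le _ _).trans (add_le_add hp1 hp2)) (by positivity)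
    _ = (M₁ + M₂) / D ^ 2 := by field_simp

/-! ## §2 The transfer-frequency integrand -/

/-- **The line algebra at transfer frequency `Ω`**: with `w = D − iΩ` (`D ≠ 0`), for numbers `n, n₂ : ℂ`, `k, k′, t : ℝ`:
`w⁻¹(n₂k) − n(w⁻¹k′t/D + w⁻²k) = w⁻¹·D·(n₂k/D − n(k′t + k)/D²) − (iΩw⁻²/D)·(nk)` — the Ω = 0 integrand times `D/(D−iΩ)` plus one extra term.
[cite: FeldmanSalmhoferTrubowitz1998, §3] -/
theorem transferKernel_integrand_eq {D Ω : ℝ} (hD : D ≠ 0) (n n₂ : ℂ) (k k' t : ℝ) :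
    ((D : ℂ) - I * Ω)⁻¹ * (n₂ * k) - n * (((D : ℂ) - I * Ω)⁻¹ * (k' * t) / D + ((D : ℂ) - I * Ω)⁻¹ ^ 2 * k) =
      ((D : ℂ) - I * Ω)⁻¹ * D * (n₂ * k / D - n * ((k' * t + k : ℝ) : ℂ) / (D : ℂ) ^ 2) -
        (I * Ω * ((D : ℂ) - I * Ω)⁻¹ ^ 2 / D) * (n * k) := by
  have hw : ((D : ℂ) - I * Ω) ≠ 0 := by
    intro h
    have := congrArg Complex.re h
    simp at this
    exact hD this
  have hDc : (D : ℂ) ≠ 0 := Complex.ofReal_ne_zero.2 hD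
  push_cast
  field_simp
  ring

/-- `‖(D − iΩ)⁻¹‖ ≤ 1/D` and `‖(D − iΩ)⁻¹‖² = 1/(D² + Ω²)` (`D > 0`). [folklore] -/
theorem norm_transfer_inv_le {D Ω : ℝ} (hD : 0 < D) :
    ‖((D : ℂ) - I * Ω)⁻¹‖ ≤ 1 / D ∧ ‖((D : ℂ) - I * Ω)⁻¹‖ ^ 2 = 1 / (D ^ 2 + Ω ^ 2) := by
  have hsq : ‖((D : ℂ) - I * Ω)‖ ^ 2 = D ^ 2 + Ω ^ 2 := by
    rw [Complex.sq_norm, Complex.normSq_apply]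
    simp
    ring
  have hre : D ≤ ‖((D : ℂ) - I * Ω)‖ := by
    have h := Complex.abs_re_le_norm ((D : ℂ) - I * Ω)
    simp at h
    rwa [abs_of_pos hD] at h
  have hpos : 0 < ‖((D : ℂ) - I * Ω)‖ := hD.trans_le hre
  refine ⟨?_, ?_⟩
  · rw [norm_inv, ← one_div]
    exact one_div_le_one_div_of_le hD hre
  · rw [norm_inv, inv_pow, hsq, one_div]

/-! ## §3 The flatness number at transfer frequency `Ω` -/

/-- **THE FLATNESS NUMBER AT NONZERO TRANSFER FREQUENCY.**  Hypotheses of `norm_integral_antidiagonal_flatness_le_of_L1_complex` for the Ω = 0 integrand `Ku₀`,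
plus `∫_0^D ‖n e‖·|κ(e/D)| de ≤ N₁`; the transfer integrand
`KuΩ(e) = w⁻¹(n₂κ(e/D)) − n(w⁻¹κ′(e/D)(e/D)/D + w⁻²κ(e/D))`, `w = D − iΩ` (`= ∂ᵤ[N·κ(e/(e+u))·(e+u−iΩ)⁻¹]` at `u = D − e`).  THEN
`‖∫_0^D KuΩ‖ ≤ (M₁ + M₂)/D² + |Ω|/(D(D² + Ω²))·N₁`. [cite: FeldmanSalmhoferTrubowitz1998, §3] -/
theorem norm_integral_antidiagonal_flatness_transfer_le {n n₁ n₂ Ku KuΩ : ℝ → ℂ} {κ κ' : ℝ → ℝ} {D Ω M₁ M₂ N₁ : ℝ} (hD : 0 < D)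
    (hn : ∀ e ∈ Icc 0 D, HasDerivAt n (n₁ e - n₂ e) e) (hn₁c : Continuous n₁) (hn₂c : Continuous n₂) (hnc : Continuous n)
    (hκ : ∀ t, HasDerivAt κ (κ' t) t) (hκ'c : Continuous κ')
    (hbd : n D * (κ 1 : ℂ) = 0)
    (hKu : ∀ e ∈ Icc 0 D, Ku e = n₂ e * (κ (e / D) : ℂ) / D - n e * ((κ' (e / D) * (e / D) + κ (e / D) : ℝ) : ℂ) / (D : ℂ) ^ 2)
    (hKuΩ : ∀ e ∈ Icc 0 D, KuΩ e = ((D : ℂ) - I * Ω)⁻¹ * (n₂ e * κ (e / D)) -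
      n e * (((D : ℂ) - I * Ω)⁻¹ * (κ' (e / D) * (e / D)) / D + ((D : ℂ) - I * Ω)⁻¹ ^ 2 * κ (e / D)))
    (hM₁ : ∫ e in (0 : ℝ)..D, ‖n₁ e‖ * |κ (e / D)| * e ≤ M₁) (hM₂ : ∫ e in (0 : ℝ)..D, ‖n₂ e‖ * |κ (e / D)| * (D - e) ≤ M₂)
    (hN₁ : ∫ e in (0 : ℝ)..D, ‖n e‖ * |κ (e / D)| ≤ N₁) :
    ‖∫ e in (0 : ℝ)..D, KuΩ e‖ ≤ (M₁ + M₂) / D ^ 2 + |Ω| / (D * (D ^ 2 + Ω ^ 2)) * N₁ := by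
  have hκc : Continuous κ := continuous_iff_continuousAt.2 fun t => (hκ t).continuousAt
  have hD0 : D ≠ 0 := hD.ne'
  set w : ℂ := (D : ℂ) - I * Ω with hw
  obtain ⟨hc1, hc2⟩ := norm_transfer_inv_le (Ω := Ω) hD
  -- pointwise decomposition on `[0, D]`
  have hpt : ∀ e ∈ uIcc (0 : ℝ) D, KuΩ e = w⁻¹ * D * Ku e - (I * Ω * w⁻¹ ^ 2 / D) * (n e * κ (e / D)) := fun e he => by
    rw [uIcc_of_le hD.le] at he
    rw [hKuΩ e he, hKu e he, hw]
    have h := transferKernel_integrand_eq (Ω := Ω) hD0 (n e) (n₂ e) (κ (e / D)) (κ' (e / D)) (e / D)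
    push_cast at h ⊢
    exact h
  -- integrability of the two pieces
  have hκD : Continuous fun e : ℝ => (κ (e / D) : ℂ) := continuous_ofReal.comp (hκc.comp (continuous_id.div_const D))
  have hKuc : ContinuousOn Ku (uIcc 0 D) := by
    rw [uIcc_of_le hD.le]
    have hcont : Continuous fun e => n₂ e * (κ (e / D) : ℂ) / D - n e * ((κ' (e / D) * (e / D) + κ (e / D) : ℝ) : ℂ) / (D : ℂ) ^ 2 :=
      ((hn₂c.mul hκD).div_const _).sub ((hnc.mul (continuous_ofReal.comp
        (((hκ'c.comp (continuous_id.div_const D)).mul (continuous_id.div_const D)).add (hκc.comp (continuous_id.div_const D))))).div_const _)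
    exact hcont.continuousOn.congr fun e he => hKu e he
  have hiKu : IntervalIntegrable Ku volume 0 D := hKuc.intervalIntegrable
  have hink : IntervalIntegrable (fun e => n e * (κ (e / D) : ℂ)) volume 0 D := (hnc.mul hκD).intervalIntegrable _ _
  rw [intervalIntegral.integral_congr hpt, intervalIntegral.integral_sub (hiKu.const_mul _) (hink.const_mul _),
    intervalIntegral.integral_const_mul, intervalIntegral.integral_const_mul]
  have h0 := norm_integral_antidiagonal_flatness_le_of_L1_complex hD hn hn₁c hn₂c hκ hκ'c hbd hKu hM₁ hM₂
  -- the extra term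
  have hN : ‖∫ e in (0 : ℝ)..D, n e * (κ (e / D) : ℂ)‖ ≤ N₁ := by
    have h := intervalIntegral.norm_integral_le_of_norm_le (μ := volume) hD.le (f := fun e => n e * (κ (e / D) : ℂ))
      (g := fun e => ‖n e‖ * |κ (e / D)|) (Filter.Eventually.of_forall fun e _ => by rw [norm_mul, Complex.norm_real, Real.norm_eq_abs])
      ((hnc.norm.mul ((hκc.comp (continuous_id.div_const D)).abs)).intervalIntegrable _ _)
    exact h.trans hN₁
  have hA : ‖w⁻¹ * D * ∫ e in (0 : ℝ)..D, Ku e‖ ≤ (M₁ + M₂) / D ^ 2 := by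
    rw [norm_mul, norm_mul, Complex.norm_of_nonneg hD.le]
    have : ‖w⁻¹‖ * D ≤ 1 := by
      calc ‖w⁻¹‖ * D ≤ 1 / D * D := mul_le_mul_of_nonneg_right hc1 hD.le
        _ = 1 := by field_simp
    calc ‖w⁻¹‖ * D * ‖∫ e in (0 : ℝ)..D, Ku e‖ ≤ 1 * ((M₁ + M₂) / D ^ 2) := mul_le_mul this h0 (norm_nonneg _) zero_le_one
      _ = (M₁ + M₂) / D ^ 2 := one_mul _
  have hB : ‖I * Ω * w⁻¹ ^ 2 / D * ∫ e in (0 : ℝ)..D, n e * (κ (e / D) : ℂ)‖ ≤ |Ω| / (D * (D ^ 2 + Ω ^ 2)) * N₁ := by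
    rw [norm_mul]
    have hcoef : ‖I * Ω * w⁻¹ ^ 2 / (D : ℂ)‖ = |Ω| / (D * (D ^ 2 + Ω ^ 2)) := by
      rw [norm_div, norm_mul, norm_mul, Complex.norm_I, one_mul, Complex.norm_real, Real.norm_eq_abs, norm_pow, hc2,
        Complex.norm_of_nonneg hD.le]
      field_simp
    rw [hcoef]
    exact mul_le_mul_of_nonneg_left hN (by positivity)
  exact (norm_sub_le _ _).trans (add_le_add hA hB)

end Summit.HubbardSuperconductivity.HubbardSuperconductivity.Theorems.C4a

end
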